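import Literature.IUT.HodgeArakelov.Cor4546SubdagStatements
import Literature.IUT.HodgeTheaters.LabelsPlusMinus
import HarnessLib

/-!
# [IUTchII] Cor 4.5 (iii) / Rmk 4.5.3 (i): the conjugate-synchronized transport datum `ActionTransport` is INHABITED

Mochizuki, *Inter-universal Teichmüller theory II*, §4 Corollary 4.5 (iii) kurims p. 132 l. 48–55 ("the various
local `F_l^⋊±`-actions … induce isomorphisms between the labeled data `Ψ_cns(†D_≻)_t` for distinct
`t ∈ LabCusp^±(†D_≻)`") and Remark 4.5.3 (i) p. 135 l. 32–37 ("conjugate synchronization")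
[claim: Mochizuki2012, status: disputed] (IUTchII §4 Cor 4.5 (iii), kurims p.132). The cell's interface
`Literature.IUT.HodgeArakelov.ActionTransport G Ψ` (`Cor4546SubdagStatements.lean`): transports
`Ψ_t ⥲ Ψ_{g•t}` along a group action, identity at `g = 1`, a cocycle in `g`, and SYNCHRONIZED (the stabiliser
of a label acts trivially).

PROOF-ONLY non-vacuity file of the abc-iut cell (L6 row call «NV-L6 WAVE», §F v1.18p; census
HOME/staging/w5/w5-d114/INHABITATION-CENSUS-L6-v3.md §A row 34: zero producers of `ActionTransport`).
MODEL (honest label): the label action is GENUINE — [IUTchI] Def. 6.1 (i)'s `𝔽_l^{⋊±} ↷ 𝔽_l`, `(λ, ±1) • z = ±z + λ`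
(abc-iut-L5's `HodgeTheaters.FlPM l` with its landed `MulAction` on `ZMod l`), or indeed ANY group action; the
labeled monoids are the SYNCHRONIZED CONSTANT family `Ψ_t := M` (one commutative monoid at every label, e.g. the
Gaussian monoid of one value profile) with the identity transports — which is precisely the situation conjugate
synchronization produces ("isomorphisms between the labeled data … for distinct `t`" independent of the group
element, Rmk 4.5.3 (i)); it is DEGENERATE in one respect, said plainly: the family does not vary with the label
as a TYPE (in the text the `Ψ_cns(†D_≻)_t` are distinct copies canonically identified). We also check that the
induced system of symmetrizing isomorphisms (`ActionTransport.toSymmetrizingIsos`, which needs transitivity of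
the label action — proved here for `𝔽_l^{⋊±} ↷ 𝔽_l` by translations, inside the proof, no instance declared) is
the identity system. No `def`/`instance`/`structure`. Nothing here takes a side on [IUTchIII] Cor. 3.12.
-/

namespace Literature.IUT.HodgeArakelov

open Literature.IUT.HodgeTheaters

universe u v u'

namespace ActionTransport

/-- **Non-vacuity of `ActionTransport` (synchronized constant family over ANY action)**: for a group `G`
acting on labels `T` and one commutative monoid `M` placed at every label, the identity transports form an
`ActionTransport G (fun _ : T => M)` — identity at `1`, a cocycle, and synchronized (stabilisers act trivially).
[claim: Mochizuki2012, status: disputed] (IUTchII §4 Rmk 4.5.3 (i), kurims p.135) -/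
theorem nonempty_const (G : Type u') [Group G] (T : Type u) [MulAction G T] (M : Type v) [CommMonoid M] :
    Nonempty (ActionTransport G (fun _ : T => M)) :=
  ⟨{ act := fun _ _ _ _ => MulEquiv.refl M
     act_one := fun _ _ => rfl
     act_mul := fun _ _ _ _ _ _ _ _ => rfl
     sync := fun _ _ _ _ => rfl }⟩

/-- **Non-vacuity at the GENUINE label action** `𝔽_l^{⋊±} ↷ 𝔽_l` of [IUTchI] Def. 6.1 (i) (`FlPM l` acting on
`ZMod l` by `(λ, ±1) • z = ±z + λ`, abc-iut-L5 `LabelsPlusMinus`): the synchronized constant family of any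
commutative monoid `M` over the `𝔽_l^{⋊±}`-labels is an `ActionTransport (FlPM l) (fun _ : ZMod l => M)`.
[claim: Mochizuki2012, status: disputed] (IUTchII §4 Cor 4.5 (iii), kurims p.132) -/
theorem nonempty_model (l : ℕ) (M : Type v) [CommMonoid M] :
    Nonempty (ActionTransport (FlPM l) (fun _ : ZMod l => M)) :=
  nonempty_const (FlPM l) (ZMod l) M

/-- The `𝔽_l^{⋊±}`-action on `𝔽_l` is TRANSITIVE (translations `(z' − z, +1)` carry `z` to `z'`) — the
hypothesis under which `ActionTransport.toSymmetrizingIsos` is defined ([IUTchII] Cor 4.5 (iii): isomorphisms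
"for distinct `t`" between ALL pairs of labels). Stated as a `Prop`, no instance declared.
[cite: Mochizuki2012, IUTchI Def 6.1 (i) p.155] -/
theorem flPM_isPretransitive (l : ℕ) : MulAction.IsPretransitive (FlPM l) (ZMod l) :=
  ⟨fun z z' => ⟨FlPM.mk (z' - z) 1, by rw [FlPM.mk_smul, one_smul, add_sub_cancel]⟩⟩

/-- **The induced symmetrizing isomorphisms of the model are the identities**: for every
`A : ActionTransport (FlPM l) (fun _ => M)` whose transports are the identity maps (such as the witness of
`nonempty_model`), the system `A.toSymmetrizingIsos` (well-defined by conjugate synchronization,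
`ActionTransport.act_eq_act`) is `σ_{t,t'} = id` — "the labeled data … for distinct `t`" are identified
canonically, independently of the group element. [claim: Mochizuki2012, status: disputed]
(IUTchII §4 Cor 4.5 (iii), kurims p.132) -/
theorem toSymmetrizingIsos_model_apply (l : ℕ) (M : Type v) [CommMonoid M]
    (A : ActionTransport (FlPM l) (fun _ : ZMod l => M))
    (hA : ∀ (g : FlPM l) (t t' : ZMod l) (h : g • t = t') (x : M), A.act g t t' h x = x)
    (t t' : ZMod l) (x : M) :
    (@ActionTransport.toSymmetrizingIsos _ _ _ _ _ _ A (flPM_isPretransitive l)).iso t t' x = x := by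
  haveI := flPM_isPretransitive l
  obtain ⟨g, hg⟩ := MulAction.exists_smul_eq (FlPM l) t t'
  rw [A.toSymmetrizingIsos_iso_apply g t t' hg x, hA]

/-- **Existence of a synchronized transport datum WITH identity symmetrizing isomorphisms over the genuine
label action** (the two previous facts combined into one closed statement).
[claim: Mochizuki2012, status: disputed] (IUTchII §4 Cor 4.5 (iii), kurims p.132) -/
theorem exists_model_symmetrizing_id (l : ℕ) (M : Type v) [CommMonoid M] :
    ∃ A : ActionTransport (FlPM l) (fun _ : ZMod l => M), ∀ (t t' : ZMod l) (x : M),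
      (@ActionTransport.toSymmetrizingIsos _ _ _ _ _ _ A (flPM_isPretransitive l)).iso t t' x = x :=
  ⟨{ act := fun _ _ _ _ => MulEquiv.refl M
     act_one := fun _ _ => rfl
     act_mul := fun _ _ _ _ _ _ _ _ => rfl
     sync := fun _ _ _ _ => rfl },
    fun t t' x => toSymmetrizingIsos_model_apply l M _ (fun _ _ _ _ _ => rfl) t t' x⟩

end ActionTransport

end Literature.IUT.HodgeArakelov
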